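import Mathlib
import Summits.Ventures.PercRepro2.Defs
import Summits.Ventures.PercRepro2.Independence
import Summits.Ventures.PercRepro2.Harris
import Summits.Ventures.PercRepro2.Graph
import Summits.Ventures.PercRepro2.Events
import Summits.Ventures.PercRepro2.ZCLeafBuilt
import Summits.Ventures.PercRepro2.ZCA3WGraph

/-!
# (ZC) on the four-cycle — Theorem E composed with the tree theorem
(blind cell PercRepro2, mine-a g24)

The cycle `0 — 1 — 2 — 3 — 0` (edges `0 = {0,1}`, `1 = {1,2}`, `2 = {2,3}`, `3 = {3,0}`) with the marks
`a₁ = 0`, `a₃ = 1`, `o = 3`: the mark `a₃ = 1` has degree two with neighbours `a₁ = 0` and the non-mark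
`w = 2`, so Theorem E (`zc_a3w_graph`) reduces (ZC) to (ZC) on `G − a₃` = the path `2 — 3 — 0` under the
weights `p[0, 1 ↦ 0]` for the marks `(0, 2, 3)` — a leaf-built graph (`zc_of_leafBuilt`).  Hence
(ZC) holds on the four-cycle for every weight vector and every cluster up-set: the first kernel instance
in which all three marks lie on a common cycle.  One seat.
-/

namespace Summit.Ventures.PercRepro2

/-- **(ZC) on the four-cycle** with the marks `a₁ = 0`, `a₃ = 1`, `o = 3` (the fourth vertex `2` is
not a mark): every weight vector, every up-set. -/
theorem zc_cycle_four {R : Type*} [CommRing R] [LinearOrder R] [IsStrictOrderedRing R]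
    {p : Fin 4 → R} (hp : IsProbVec p) {𝓔 : Set (Set (Fin 4))} (h𝓔 : IsUpperSet 𝓔) :
    let ends : Fin 4 → Sym2 (Fin 4) := ![s(0, 1), s(1, 2), s(2, 3), s(3, 0)]
    let e := connEvent ends 0 1
    let L' := connEvent ends 0 3
    let U := clusterInEvent ends 0 𝓔
    let γ := connEvent ends 1 3
    0 ≤ prob p (eᶜ ∩ L'ᶜ ∩ γᶜ) * (prob p (U ∩ (e ∩ L')) - prob p U * prob p (e ∩ L'))
      - prob p (eᶜ ∩ L'ᶜ ∩ γ) * (prob p (U ∩ (e ∩ L'ᶜ)) - prob p U * prob p (e ∩ L'ᶜ)) := by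
  intro ends e L' U γ
  have hE := zc_a3w_graph (a₁ := (0 : Fin 4)) (a₃ := 1) (o := 3) (w := 2) (f₁ := (0 : Fin 4)) (f₂ := 1)
    hp (ends := ends) (by decide) (by simp [ends, Sym2.eq_swap]) (by simp [ends])
    (by intro e he; fin_cases e <;> simp [ends, Sym2.mem_iff] at he ⊢)
    (by decide) (by decide) h𝓔 ?_
  · simpa using hE
  · -- the reduced graph is the path `2 — 3 — 0`: leaf-built
    simp only
    have hL := zc_of_leafBuilt (ends := ends) [((2 : Fin 4), (3 : Fin 4), (2 : Fin 4)), (3, 0, 3)]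
      (by simp [ends, List.pairwise_cons, Sym2.mem_iff])
      (by simp [ends])
      (Function.update (Function.update p 0 0) 1 0)
      ((hp.update 0 le_rfl zero_le_one).update 1 le_rfl zero_le_one)
      (by
        intro e he
        fin_cases e <;> simp at he ⊢)
      0 2 3 {S | insert 1 S ∈ 𝓔} (isUpperSet_rootShift h𝓔 1)
    simpa using hL

end Summit.Ventures.PercRepro2
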